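import Summits.Langlands.Langlands.Theses.PicardMuOrdinary
import Literature.AlgebraicGeometry.Motives.PicardCurveMuOrdinaryReduction

/-!
# `IrregularClassicality` (stmt-Langlands-13758) — Negative knowledge VI: the PICKED line's case
# split is on the curve-level μ-ordinarity predicate; its remainder stub is a costume of the crux

From the standing disprover's `Cruxes/IrregularClassicality/Disproof.lean`, cdisprove cycle 4
(2026-08-16), §13.  The crux is NOT refuted (it is the target X weakened by a hypothesis).  The lead
picked `Cruxes/IrregularClassicality/Lines/split-ramified-prime-sqrt6.lean`, whose composition is
`by_cases Literature.AlgebraicGeometry.Motives.HasMuOrdinaryReductionAtThree f` (definition request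
D1 of the route: the CURVE `y³ = f(x)` has potentially good reduction at `3` of `3`-rank `2`).
Börner–Bouw–Wewers 2017, §3.2 Lemma 4 (arXiv:1701.01986 p. 6; found by the drefute seat, re-read by
the disprover): over the absolutely unramified base `ℚ₃^{nr}` an étale genus-3 component of the
stable reduction of a Picard curve has ONE branch point — the two-branch-point (3-rank-2) type
"does not occur" — so for `f ∈ ℤ[X]` potentially good reduction is always the supersingular
Hermitian curve `y³ - y = x⁴`, and the predicate is EMPTY on separable quartics over `ℤ`.  That
emptiness needs stable reduction and is not provable in the tree; here it is an explicit
hypothesis `hvac`, and what lands is the pure-logic consequence for the line: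

* `nonMuOrdinaryRemainder_of_irregularClassicality`: the line's Stub 7 ("conceded remainder") is a
  weakening of the crux (unconditional);
* `irregularClassicality_iff_nonMuOrdinaryRemainder`: under `hvac` it IS the crux — the
  kernel-checked composition of the line reduces to Stub 7, a costume;
* `muOrdinaryGuardedStub_of_vacuity`, `muOrdinaryGuardedStub_of_vacuity'`: under `hvac` every
  statement guarded by `HasMuOrdinaryReductionAtThree f` after the admissibility hypotheses —
  the line's Stub 3 `stub_polarizedTwistedTower` and its heart Stub 5
  `stub_twoWallOrdinaryClassicality` have this shape — holds vacuously, whatever its conclusion;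
* `picard_no_tau_for_jumps_one_two`: the combinatorial heart of BBW's exclusion — in characteristic
  `≠ 2` no order `m` admits primitive `m`-th roots of unity `ζ₁, ζ₂` with `ζ₁ = -1`, `ζ₂² = -1`
  (the linearised constraints `ζ^{h_i} = -1` for `τ σ τ⁻¹ = σ⁻¹` at ramification points of lower
  jumps `1` and `2`).

Repair recorded in the Disproof file (item 24): type μ-ordinarity on the JACOBIAN (BBW stable type
(b); anchor `f = 3x⁴ + x³ - 54`, admissible with `Gal = S₄`, item 25) or on the Galois side, never
on the curve.  Mathlib + the route file + `Literature/AlgebraicGeometry/Motives/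
PicardCurveMuOrdinaryReduction` only; no statement here asserts a Theses decl.
[cite: BornerBouwWewers2017, §3.2 Lemma 4 (arXiv:1701.01986 numbering)]
-/

set_option linter.dupNamespace false

namespace Summit.Langlands.Langlands.Theorems.IrregularClassicality.Negative

open Summit.Langlands.Langlands.Theses.PicardMuOrdinary
open Literature.NumberTheory.Automorphic Literature.NumberTheory.GaloisRepresentations
open Literature.AlgebraicGeometry.Motives
open NumberField IsDedekindDomain Polynomial Filter

open scoped Classical

/-- **Stub 7 `stub_nonMuOrdinaryRemainder` of `Lines/split-ramified-prime-sqrt6` is a weakening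
of the crux** (its statement, verbatim, is the crux with the extra hypothesis
`¬ HasMuOrdinaryReductionAtThree f`). [folklore] -/
theorem nonMuOrdinaryRemainder_of_irregularClassicality (h : IrregularClassicality) :
    ∀ (f : ℤ[X]) (hcpt : isCompact_glFiniteIntegralLevel 3 (CyclotomicField 3 ℚ)),
      f.natDegree = 4 → (f.map (Int.castRingHom ℚ)).Separable →
      12 ∣ Nat.card (f.map (Int.castRingHom ℚ)).Gal →
      ¬ HasMuOrdinaryReductionAtThree f →
      (∃ (e : CyclotomicField 3 ℚ →+* ℂ) (𝔐 : Ideal (integralClosure ℤ ℂ))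
          (S : Finset (HeightOneSpectrum (𝓞 (CyclotomicField 3 ℚ)))),
          𝔐.IsMaximal ∧ (3 : integralClosure ℤ ℂ) ∈ 𝔐 ∧
          ∀ k : ℕ, ∃ P : CuspidalAutomorphicRepData 3 (CyclotomicField 3 ℚ) hcpt,
            P.1.IsRegularAlgebraic ∧
            ∀ 𝔭 ∉ S, ∃ (α : Multiset ℂ) (t u : integralClosure ℤ ℂ),
              P.1.HasSatakeParamAt 𝔭 α ∧
              (t : ℂ) = (𝔭.residueCard : ℂ) * α.sum - e (picardTrace f 𝔭) ∧
              u ∉ 𝔐 ∧ u * t ∈ Ideal.span {(3 : integralClosure ℤ ℂ) ^ k}) →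
      ∃ (e : CyclotomicField 3 ℚ →+* ℂ) (π : CuspidalAutomorphicRepData 3 (CyclotomicField 3 ℚ) hcpt),
        π.1.IsLAlgebraic ∧
        ∀ᶠ 𝔭 : HeightOneSpectrum (𝓞 (CyclotomicField 3 ℚ)) in Filter.cofinite, ∃ α : Multiset ℂ,
          π.1.HasSatakeParamAt 𝔭 α ∧ α.sum = e (picardTrace f 𝔭) :=
  fun f hcpt hdeg hsep hgal _ hlim => h f hcpt hdeg hsep hgal hlim

/-- **Costume, modulo curve-level vacuity.**  If `HasMuOrdinaryReductionAtThree f` fails for every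
admissible `f` (Börner–Bouw–Wewers 2017, §3.2 Lemma 4: the 3-rank-2 potentially good type does not
occur over `ℚ₃^{nr}`; paper theorem, hypothesis `hvac` here), then the line's "conceded remainder"
Stub 7 is EQUIVALENT to the crux `IrregularClassicality`: the case split of
`Lines/split-ramified-prime-sqrt6.lean` sends every admissible `f` to the remainder branch.
[cite: BornerBouwWewers2017, §3.2 Lemma 4 (arXiv:1701.01986 numbering)] -/
theorem irregularClassicality_iff_nonMuOrdinaryRemainder
    (hvac : ∀ f : ℤ[X], f.natDegree = 4 → (f.map (Int.castRingHom ℚ)).Separable →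
      12 ∣ Nat.card (f.map (Int.castRingHom ℚ)).Gal → ¬ HasMuOrdinaryReductionAtThree f) :
    IrregularClassicality ↔
    ∀ (f : ℤ[X]) (hcpt : isCompact_glFiniteIntegralLevel 3 (CyclotomicField 3 ℚ)),
      f.natDegree = 4 → (f.map (Int.castRingHom ℚ)).Separable →
      12 ∣ Nat.card (f.map (Int.castRingHom ℚ)).Gal →
      ¬ HasMuOrdinaryReductionAtThree f →
      (∃ (e : CyclotomicField 3 ℚ →+* ℂ) (𝔐 : Ideal (integralClosure ℤ ℂ))
          (S : Finset (HeightOneSpectrum (𝓞 (CyclotomicField 3 ℚ)))),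
          𝔐.IsMaximal ∧ (3 : integralClosure ℤ ℂ) ∈ 𝔐 ∧
          ∀ k : ℕ, ∃ P : CuspidalAutomorphicRepData 3 (CyclotomicField 3 ℚ) hcpt,
            P.1.IsRegularAlgebraic ∧
            ∀ 𝔭 ∉ S, ∃ (α : Multiset ℂ) (t u : integralClosure ℤ ℂ),
              P.1.HasSatakeParamAt 𝔭 α ∧
              (t : ℂ) = (𝔭.residueCard : ℂ) * α.sum - e (picardTrace f 𝔭) ∧
              u ∉ 𝔐 ∧ u * t ∈ Ideal.span {(3 : integralClosure ℤ ℂ) ^ k}) →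
      ∃ (e : CyclotomicField 3 ℚ →+* ℂ) (π : CuspidalAutomorphicRepData 3 (CyclotomicField 3 ℚ) hcpt),
        π.1.IsLAlgebraic ∧
        ∀ᶠ 𝔭 : HeightOneSpectrum (𝓞 (CyclotomicField 3 ℚ)) in Filter.cofinite, ∃ α : Multiset ℂ,
          π.1.HasSatakeParamAt 𝔭 α ∧ α.sum = e (picardTrace f 𝔭) :=
  ⟨nonMuOrdinaryRemainder_of_irregularClassicality,
    fun h f hcpt hdeg hsep hgal hlim => h f hcpt hdeg hsep hgal (hvac f hdeg hsep hgal) hlim⟩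

/-- **Every μ-ordinary-guarded stub is vacuously true under curve-level vacuity**, whatever its
conclusion `Q` — the shape of the line's heart Stub 5 `stub_twoWallOrdinaryClassicality`
(`∀ f, natDegree = 4 → separable → 12 ∣ #Gal → HasMuOrdinaryReductionAtThree f → …`).
[cite: BornerBouwWewers2017, §3.2 Lemma 4 (arXiv:1701.01986 numbering)] -/
theorem muOrdinaryGuardedStub_of_vacuity
    (hvac : ∀ f : ℤ[X], f.natDegree = 4 → (f.map (Int.castRingHom ℚ)).Separable →
      12 ∣ Nat.card (f.map (Int.castRingHom ℚ)).Gal → ¬ HasMuOrdinaryReductionAtThree f)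
    (Q : ℤ[X] → Prop) :
    ∀ f : ℤ[X], f.natDegree = 4 → (f.map (Int.castRingHom ℚ)).Separable →
      12 ∣ Nat.card (f.map (Int.castRingHom ℚ)).Gal → HasMuOrdinaryReductionAtThree f → Q f :=
  fun f hdeg hsep hgal hmu => (hvac f hdeg hsep hgal hmu).elim

/-- The same with the level datum bound before the degree hypothesis — the binder order of the
line's Stub 3 `stub_polarizedTwistedTower`. [folklore] -/
theorem muOrdinaryGuardedStub_of_vacuity'
    (hvac : ∀ f : ℤ[X], f.natDegree = 4 → (f.map (Int.castRingHom ℚ)).Separable →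
      12 ∣ Nat.card (f.map (Int.castRingHom ℚ)).Gal → ¬ HasMuOrdinaryReductionAtThree f)
    (Q : ℤ[X] → isCompact_glFiniteIntegralLevel 3 (CyclotomicField 3 ℚ) → Prop) :
    ∀ (f : ℤ[X]) (hcpt : isCompact_glFiniteIntegralLevel 3 (CyclotomicField 3 ℚ)),
      f.natDegree = 4 → (f.map (Int.castRingHom ℚ)).Separable →
      12 ∣ Nat.card (f.map (Int.castRingHom ℚ)).Gal → HasMuOrdinaryReductionAtThree f → Q f hcpt :=
  fun f _ hdeg hsep hgal hmu => (hvac f hdeg hsep hgal hmu).elim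

/-- **The combinatorial heart of the exclusion (shadow of BBW `lem:genuscomp`).**  In characteristic
`≠ 2` no single order `m` admits primitive `m`-th roots of unity `ζ₁, ζ₂` with `ζ₁¹ = -1` and
`ζ₂² = -1`: the linearised constraints `ζ^{h_i} = -1` for `τ σ τ⁻¹ = σ⁻¹` at the two ramification
points of lower jumps `h₁ = 1`, `h₂ = 2` of a hypothetical 3-rank-2 good special fibre would force
the order of `τ` to be `2` and `4` at once. [cite: BornerBouwWewers2017, §3.2 Lemma 4 (arXiv:1701.01986 numbering)] -/
theorem picard_no_tau_for_jumps_one_two {L : Type*} [Field L] (h2 : (2 : L) ≠ 0) {m : ℕ}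
    {ζ₁ ζ₂ : L} (h₁ : IsPrimitiveRoot ζ₁ m) (h₂ : IsPrimitiveRoot ζ₂ m) (hj₁ : ζ₁ ^ 1 = -1)
    (hj₂ : ζ₂ ^ 2 = -1) : False := by
  rw [pow_one] at hj₁
  have hm2 : m ∣ 2 := h₁.dvd_of_pow_eq_one 2 (by rw [hj₁]; norm_num)
  have hm1 : m ≠ 1 := by
    rintro rfl
    have : ζ₁ = 1 := IsPrimitiveRoot.one_right_iff.1 h₁
    rw [this] at hj₁
    exact h2 (by linear_combination hj₁)
  have hm : m = 2 := by
    rcases (Nat.dvd_prime Nat.prime_two).1 hm2 with h | h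
    · exact (hm1 h).elim
    · exact h
  subst hm
  have h1 : ζ₂ ^ 2 = 1 := h₂.pow_eq_one
  rw [h1] at hj₂
  exact h2 (by linear_combination hj₂)

end Summit.Langlands.Langlands.Theorems.IrregularClassicality.Negative
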